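import Summits.QuantumFields.BalabanUV.Beta.SecondOrderBorderGauge

/-!
# `BalabanUV.Beta.SecondOrderBorderGaugeWall` — binder row D1, (L4): THE WALL'S LEVEL-0 BORDER CONTACT IS REFLECTION-ANTI-INVARIANT;
# THE SINGLE-AXIS MODEL OF THE END's BORDER LETTER (β sub-cell, row BETA-an2 = BINDER-OWNERS row D1 OWNER, lineage an2 gen 20, K-L1 part 2)

HONEST FRAMING (cell charter, verbatim): «discharging BetaPertH makes Balaban's UV stability UNCONDITIONAL — a real
constructive-QFT result; it is NOT the continuum limit and NOT the Clay problem.»  Neutral kernel algebra ([folklore]), entrywise; no statement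
of Bałaban's papers, no `[cite:]`, no `Prop` fact; instantiates no binder of the wall.  NOT D1, NOT `BetaPertH`, NOT continuum, NOT Clay.

WHAT (instance of `SecondOrderBorderGauge` at the wall's level-0 data, `d + 1 = 4`, odd `Lc`, centred root, pins `(cE, cVH) = (Lc⁴, −Lc⁸∕2)`,
`γ 0 = −Lc⁴∕2` under the END's `hγ`):
* `ctGen_fref` (generic `d`): **the reflection law of the product-chart generator** — `ctGen α′ L κ (bref α κ u) (Φ_α.r b z) b =
  ε_α(κ)ε_α(α′)·ctGen α′ L κ u z b` (field leg: the indicator; multiplier leg: an5's `linKerAt_fref` + `blk_mref`/`off_mref_eq_zero_iff`);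
  the generator of the reflected axis is `α`-ODD (`ctGen_fref_self`), that of another axis `α`-EVEN (`ctGen_fref_of_ne`).
* `wallD₀ Lc cΛ γ α` := the `conjW` contact of the END's (hBe) at `j = 0` as a bi-table (`wallD₀_eq`: literally the END's term).
* `actS_SpureRecAt_zero`: the level-0 first-order law (`SpineRecursivePureLaws.pureZero_bref`, locks by `locks_of_pin`/`pin_of_bcj`) in
  action form; hence **`actB_wallD₀`**: `actB Lc α (wallD₀ … α) = −wallD₀ … α` — the necessary condition for (hBe) to have ANY solution holds.
* **`wall_single_axis_letter₀`**: for each axis `α` SEPARATELY, `vh := −(2cB)⁻¹ • wallD₀ … α` satisfies the END's (hBe) at `j = 0` on every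
  leg pair (`cB ≠ 0`).  ONE table for all four axes, its classes and the END corollary: K-L2 `SecondOrderBorderModel`.
HONEST: a model of the socket is NOT an identification of Bałaban's second-order border jet (= an1's letter); 0∕4 binders.
Provenance: β sub-cell, unit beta-an2 gen 20, 2026-08-20 (v1); no existing file touched.
-/

open Finset
open scoped BigOperators
open Literature.MathematicalPhysics.QuantumFieldTheory
open Literature.MathematicalPhysics.QuantumFieldTheory.Balaban1983to89
open Literature.MathematicalPhysics.QuantumFieldTheory.Balaban1983to89.Beta
open ExpKernelCalculus (MKer)
open AffineAveraging (box toSite)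
open AveragingContours (blk off)
open AveragingContoursRooted (ctr ctrOff ctrOff_mem_box)
open AveragingHessianKernels (Bond)
open AveragingHessianKernelsRooted (vhSAt linKerAt)
open PolarizationSign (reflSign)
open KernelReflection (LegMap refK refK_apply)
open ResolventReflection (sref bref bref_bref bref_apply mref mref_mref mref_zsmul Φ Φ_r_inl Φ_r_inr Φ_s_inl Φ_s_inr reflSign_mul_self
  reflSign_self reflSign_of_ne)
open RootedKernelReflection (fref linKerAt_fref off_mref_eq_zero_iff blk_mref)
open OneStepResolventKernel (Fib)
open StepJetData (wilsonA)
open BalabanStepJetsSucc (wE wVH)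
open BalabanStepW2 (wB2)
open Summit.QuantumFields.BalabanUV.Beta.TameKernelCalculus
open Summit.QuantumFields.BalabanUV.Beta.ChartConjugation (conjV conjW)
open Summit.QuantumFields.BalabanUV.Beta.BorderedHessian (diagK diagK_apply ctGen ctGen_inl ctGen_inr bhKStepAt bhKStepAt_zero stepScale
  conjV_diagK_apply)
open Summit.QuantumFields.BalabanUV.Beta.E3LevelOneReflection (refK_add refK_smul refK_sub refK_Φ_refK_Φ Φ_r_r)
open Summit.QuantumFields.BalabanUV.Beta.VertexReflectionContact (refK_neg smul_diagK)
open Summit.QuantumFields.BalabanUV.Beta.SpineRooted (SpureRecAt SpureRecAt_zero_level pureZero_bref locks_of_pin pin_of_bcj)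
open Summit.QuantumFields.BalabanUV.Beta.SecondOrderBorderGauge

namespace Summit.QuantumFields.BalabanUV.Beta.SecondOrderBorderGaugeWall

noncomputable section

variable {d : ℕ}

/-! ## §1 The reflection law of the product-chart generator -/

section Generator

/-- [folklore] **THE REFLECTION LAW OF THE PRODUCT-CHART GENERATOR** (centred root, odd `L`; every pair of axes `α`, `α′`, every leg):
`ctGen α′ L κ (bref α κ u) (Φ_α.r b z) b = ε_α(κ)·ε_α(α′) · ctGen α′ L κ u z b` — the generator of axis `α′` is `α`-ODD for `α′ = α` and
`α`-EVEN for `α′ ≠ α` (field leg: the indicator; multiplier leg: an5's pure sign law `linKerAt_fref` + `blk_mref` / `off_mref_eq_zero_iff`). -/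
theorem ctGen_fref {L : ℕ} (hL : Odd L) (α α' κ : Fin (d + 1)) (u z : Fin (d + 1) → ℤ) (b : Fib d) :
    ctGen d α' L κ (bref α κ u) ((Φ (d := d) L α).r b z) b = reflSign α κ * reflSign α α' * ctGen d α' L κ u z b := by
  classical
  rcases b with β | μ
  · rw [Φ_r_inl, ctGen_inl, ctGen_inl]
    by_cases h : β = κ ∧ κ = α'
    · obtain ⟨hβ, hκ⟩ := h
      have hs : reflSign α κ * reflSign α α' = 1 := by rw [← hκ]; exact reflSign_mul_self α κ
      by_cases hz : z = u
      · rw [if_pos ⟨by rw [hβ, hz], hβ, hκ⟩, if_pos ⟨hz, hβ, hκ⟩, hs]; ring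
      · have hne : bref α β z ≠ bref α κ u := by
          rw [hβ]; intro e
          exact hz (by simpa only [bref_bref] using congrArg (bref α κ) e)
        rw [if_neg (fun hc => hne hc.1), if_neg (fun hc => hz hc.1), mul_zero]
    · rw [if_neg (fun hc => h hc.2), if_neg (fun hc => h hc.2), mul_zero]
  · rw [Φ_r_inr, ctGen_inr, ctGen_inr]
    by_cases h : μ = α' ∧ off L z = 0
    · obtain ⟨hμ, hz⟩ := h
      have hz' : off L (mref L α μ z) = 0 := (off_mref_eq_zero_iff hL.pos α μ z).2 hz
      rw [if_pos ⟨hμ, hz'⟩, if_pos ⟨hμ, hz⟩, blk_mref hL.pos α μ hz]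
      have e := linKerAt_fref hL α μ (bref α μ (blk L z)) (κ, u)
      rw [bref_bref] at e
      rw [show ((κ, bref α κ u) : Bond (d + 1)) = fref α (κ, u) from rfl, e, hμ]
      ring
    · have h' : ¬(μ = α' ∧ off L (mref L α μ z) = 0) := fun hc => h ⟨hc.1, (off_mref_eq_zero_iff hL.pos α μ z).1 hc.2⟩
      rw [if_neg h', if_neg h, mul_zero]

/-- [folklore] The generator of the reflected axis itself is `α`-ODD: `ctGen α L κ (bref α κ u) (Φ_α.r b z) b = −ε_κ · ctGen α L κ u z b`. -/
theorem ctGen_fref_self {L : ℕ} (hL : Odd L) (α κ : Fin (d + 1)) (u z : Fin (d + 1) → ℤ) (b : Fib d) :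
    ctGen d α L κ (bref α κ u) ((Φ (d := d) L α).r b z) b = -reflSign α κ * ctGen d α L κ u z b := by
  rw [ctGen_fref hL, reflSign_self]; ring

/-- [folklore] The generator of another axis is `α`-EVEN: `ctGen α′ L κ (bref α κ u) (Φ_α.r b z) b = ε_κ · ctGen α′ L κ u z b` (`α′ ≠ α`). -/
theorem ctGen_fref_of_ne {L : ℕ} (hL : Odd L) {α α' : Fin (d + 1)} (h : α' ≠ α) (κ : Fin (d + 1)) (u z : Fin (d + 1) → ℤ) (b : Fib d) :
    ctGen d α' L κ (bref α κ u) ((Φ (d := d) L α).r b z) b = reflSign α κ * ctGen d α' L κ u z b := by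
  rw [ctGen_fref hL, reflSign_of_ne h, mul_one]

end Generator

/-! ## §2 The wall's level-0 border contact: anti-invariance and the single-axis letter -/

section Wall

variable {Lc : ℕ} [NeZero Lc]

/-- [our object] **THE LEVEL-0 BORDER CONTACT OF THE WALL** (the `conjW` term of the END's (hBe) at `j = 0`, as a bi-table; `γ 0 = −Lc⁴∕2` under the
END's `hγ`): `wallD₀ cΛ γ α := canonD (bhKStepAt 3 ρ_c Lc 0) (SpureRecAt 3 Lc ρ_c Lc⁴ (−Lc⁸∕2) cΛ 0) (γ 0 · ctGen 3 α Lc)`. -/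
def wallD₀ (Lc : ℕ) [NeZero Lc] (cΛ : ℝ) (γ : ℕ → ℝ) (α : Fin 4) : Fin 4 → (Fin 4 → ℤ) → Fin 4 → (Fin 4 → ℤ) → MKer 4 (Fib 3) :=
  canonD (bhKStepAt 3 (toSite (ctrOff 4 Lc)) Lc 0) (SpureRecAt 3 Lc (toSite (ctrOff 4 Lc)) ((Lc : ℝ) ^ 4) (-((Lc : ℝ) ^ 8 / 2)) cΛ 0)
    (fun κ u p c => γ 0 * ctGen 3 α Lc κ u p c)

/-- [folklore] `wallD₀` IS the contact of the END's border socket at `j = 0` (the second symbol `γ₀²·ĉt·ĉt′` is the canonical `(γ₀ĉt)·(γ₀ĉt′)`). -/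
theorem wallD₀_eq (cΛ : ℝ) (γ : ℕ → ℝ) (α κ : Fin 4) (u : Fin 4 → ℤ) (κ' : Fin 4) (u' : Fin 4 → ℤ) :
    wallD₀ Lc cΛ γ α κ u κ' u' =
      conjW (bhKStepAt 3 (toSite (ctrOff 4 Lc)) Lc 0)
        (SpureRecAt 3 Lc (toSite (ctrOff 4 Lc)) ((Lc : ℝ) ^ 4) (-((Lc : ℝ) ^ 8 / 2)) cΛ 0 κ u)
        (SpureRecAt 3 Lc (toSite (ctrOff 4 Lc)) ((Lc : ℝ) ^ 4) (-((Lc : ℝ) ^ 8 / 2)) cΛ 0 κ' u')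
        (diagK fun p c => γ 0 * ctGen 3 α Lc κ u p c) (diagK fun p c => γ 0 * ctGen 3 α Lc κ' u' p c)
        (diagK fun p c => γ 0 ^ 2 * (ctGen 3 α Lc κ u p c * ctGen 3 α Lc κ' u' p c)) := by
  have e : (fun p c => γ 0 * ctGen 3 α Lc κ u p c * (γ 0 * ctGen 3 α Lc κ' u' p c)) =
      fun p c => γ 0 ^ 2 * (ctGen 3 α Lc κ u p c * ctGen 3 α Lc κ' u' p c) := by
    funext p c; ring
  show conjW _ _ _ _ _ (diagK fun p c => γ 0 * ctGen 3 α Lc κ u p c * (γ 0 * ctGen 3 α Lc κ' u' p c)) = _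
  rw [e]

/-- [folklore] **THE LEVEL-0 FIRST-ORDER LAW OF THE WALL IN ACTION FORM** (`SpineRecursivePureLaws.pureZero_bref` at the pins
`(cE, cVH) = (Lc⁴, −Lc⁸∕2)`, locks by `locks_of_pin`/`pin_of_bcj`):
`actS Lc α S₀ = S₀ + conjV (bhKStepAt 0) (diagK (γ₀·ctGen α))`, `S₀ := SpureRecAt … 0`. -/
theorem actS_SpureRecAt_zero (hLc : Odd Lc) (cΛ : ℝ) (γ : ℕ → ℝ)
    (hγ : ∀ j, γ j = -((Lc : ℝ) ^ 8 / 2) * wVH 3 Lc j / (stepScale 3 Lc j * (Lc : ℝ) ^ 4)) (α : Fin 4) :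
    actS Lc α (SpureRecAt 3 Lc (toSite (ctrOff 4 Lc)) ((Lc : ℝ) ^ 4) (-((Lc : ℝ) ^ 8 / 2)) cΛ 0) =
      fun κ u => SpureRecAt 3 Lc (toSite (ctrOff 4 Lc)) ((Lc : ℝ) ^ 4) (-((Lc : ℝ) ^ 8 / 2)) cΛ 0 κ u +
        conjV (bhKStepAt 3 (toSite (ctrOff 4 Lc)) Lc 0) (diagK fun p c => γ 0 * ctGen 3 α Lc κ u p c) := by
  have hn : 2 * (-((Lc : ℝ) ^ 8 / 2)) = -((Lc : ℝ) ^ 4 * (Lc : ℝ) ^ 4) := by ring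
  have hγ' : ∀ j, γ j = -((Lc : ℝ) ^ 8 / 2) * wVH 3 Lc j / (stepScale 3 Lc j * (Lc : ℝ) ^ 4) := hγ
  have hlock : ∀ j, (Lc : ℝ) ^ 4 * wE 3 Lc (j + 1) * (γ j / (stepScale 3 Lc j * (Lc : ℝ) ^ 4 * wVH 3 Lc (j + 1))) = γ (j + 1) := by
    intro j
    rw [hγ' j, hγ' (j + 1)]
    exact locks_of_pin ((Lc : ℝ) ^ 4) (-((Lc : ℝ) ^ 8 / 2)) (pin_of_bcj ((Lc : ℝ) ^ 4) rfl) j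
  refine actS_eq_of_law Lc α (fun κ u => ?_)
  have h := pureZero_bref hLc ((Lc : ℝ) ^ 4) (-((Lc : ℝ) ^ 8 / 2)) cΛ hn γ hγ' hlock α κ u
  rw [SpureRecAt_zero_level, smul_diagK] at *
  exact h

/-- [folklore] **THE LEVEL-0 BORDER CONTACT OF THE WALL IS `α`-ANTI-INVARIANT**: `actB Lc α (wallD₀ cΛ γ α) = −wallD₀ cΛ γ α`. -/
theorem actB_wallD₀ (hLc : Odd Lc) (cΛ : ℝ) (γ : ℕ → ℝ)
    (hγ : ∀ j, γ j = -((Lc : ℝ) ^ 8 / 2) * wVH 3 Lc j / (stepScale 3 Lc j * (Lc : ℝ) ^ 4)) (α : Fin 4) :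
    actB Lc α (wallD₀ Lc cΛ γ α) = -wallD₀ Lc cΛ γ α :=
  actB_canonD (actS_SpureRecAt_zero hLc cΛ γ hγ α) (fun κ u z b => by
    show γ 0 * ctGen 3 α Lc κ (bref α κ u) ((Φ (d := 3) Lc α).r b z) b = -reflSign α κ * (γ 0 * ctGen 3 α Lc κ u z b)
    rw [ctGen_fref_self hLc]; ring)

/-- [folklore] **THE SINGLE-AXIS LETTER AT LEVEL 0**: for each axis `α` SEPARATELY, the bi-table `vh := −(2cB)⁻¹ • wallD₀ cΛ γ α` satisfies the END's
border letter (hBe) at `j = 0` for that axis, on EVERY leg pair (in particular `fm`); `cB ≠ 0`.  (One table for all four axes: K-L2.) -/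
theorem wall_single_axis_letter₀ (hLc : Odd Lc) (cΛ cB : ℝ) (hcB : cB ≠ 0) (γ : ℕ → ℝ)
    (hγ : ∀ j, γ j = -((Lc : ℝ) ^ 8 / 2) * wVH 3 Lc j / (stepScale 3 Lc j * (Lc : ℝ) ^ 4)) (α κ : Fin 4) (u : Fin 4 → ℤ) (κ' : Fin 4)
    (u' : Fin 4 → ℤ) (x z : Fin 4 → ℤ) (a b : Fib 3) :
    ((cB * wB2 3 Lc 0) • ((-(1 / (2 * cB))) • wallD₀ Lc cΛ γ α) κ (bref α κ u) κ' (bref α κ' u')) x z a b =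
      ((reflSign α κ * reflSign α κ') • refK (Φ Lc α) ((cB * wB2 3 Lc 0) • ((-(1 / (2 * cB))) • wallD₀ Lc cΛ γ α) κ u κ' u' +
        conjW (bhKStepAt 3 (toSite (ctrOff 4 Lc)) Lc 0)
          (SpureRecAt 3 Lc (toSite (ctrOff 4 Lc)) ((Lc : ℝ) ^ 4) (-((Lc : ℝ) ^ 8 / 2)) cΛ 0 κ u)
          (SpureRecAt 3 Lc (toSite (ctrOff 4 Lc)) ((Lc : ℝ) ^ 4) (-((Lc : ℝ) ^ 8 / 2)) cΛ 0 κ' u')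
          (diagK fun p c => γ 0 * ctGen 3 α Lc κ u p c) (diagK fun p c => γ 0 * ctGen 3 α Lc κ' u' p c)
          (diagK fun p c => γ 0 ^ 2 * (ctGen 3 α Lc κ u p c * ctGen 3 α Lc κ' u' p c)))) x z a b := by
  have hw : wB2 3 Lc 0 = 1 := by simp [BalabanStepW2.wB2]
  -- the weighted table is `−½ • wallD₀`
  have hG : (fun κ u κ' u' => (cB * wB2 3 Lc 0) • ((-(1 / (2 * cB))) • wallD₀ Lc cΛ γ α) κ u κ' u') =
      (-(1 / 2 : ℝ)) • wallD₀ Lc cΛ γ α := by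
    funext κ u κ' u'
    rw [hw, mul_one, Pi.smul_apply, Pi.smul_apply, Pi.smul_apply, Pi.smul_apply, smul_smul]
    congr 1
    field_simp
  have hmodel := single_axis_model (actB_wallD₀ hLc cΛ γ hγ α)
  rw [← hG] at hmodel
  rw [← wallD₀_eq]
  revert x z
  rw [letter_iff_actB Lc α (fun κ u κ' u' => (cB * wB2 3 Lc 0) • ((-(1 / (2 * cB))) • wallD₀ Lc cΛ γ α) κ u κ' u') (wallD₀ Lc cΛ γ α)
    κ u κ' u' a b]
  intro x z
  have e := congrFun (congrFun (congrFun (congrFun hmodel κ) u) κ') u'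
  simp only [Pi.sub_apply] at e
  rw [e]

end Wall

end

end Summit.QuantumFields.BalabanUV.Beta.SecondOrderBorderGaugeWall
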